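import Literature.Geometry.Riemannian.BamlerDistanceDistortionProofs
import Literature.Geometry.Riemannian.MetricFlowPhiDensity
import HarnessLib

/-!
# Two calculus lemmas for Bamler's heat-kernel gradient bound (Bamler 2020a, §4.3, (4.7))

Auxiliaries for the proof of R. Bamler, *Entropy and heat kernel bounds on a Ricci flow background*,
arXiv:2008.07093 (2020a), §4.3, display (4.7): "Applying Theorem 4.1 to `(1−2ε)u + ε` … implies
that `∫_X q dν ≤ Φ'(Φ⁻¹(ν(X))) =: F(ν(X))`", where `u(x,1) = ν_{x,1;0}(X)` and the derivative is
taken in the base point along a unit vector. The tree has Theorem 4.1 for indicator data in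
LIPSCHITZ form (`ofReal_abs_PhiInv_heatKernelMeasure_sub_le`: `Φ⁻¹ ∘ (x ↦ ν_{x,t;s}(X))` is
`(t−s)^{-1/2}`-Lipschitz for `d_{g_t}`); this file supplies the two elementary steps that turn such
a Lipschitz bound into a bound for the derivative along a curve:

* `abs_deriv_le_of_abs_PhiInv_sub_le` — if `u : ℝ → (0,1)` is differentiable at `0` and
  `|Φ⁻¹(u σ) − Φ⁻¹(u 0)| ≤ L ρ(σ)` with `ρ(σ) ≤ (1+ε)|σ|` near `0` for every `ε > 0`, then
  `|u'(0)| ≤ L · Φ'(Φ⁻¹(u 0))` (mean value theorem for `Φ` and continuity of `Φ'`);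
* `eventually_edist_toReal_le_of_speed_le_one` — along a `C^∞` curve `γ` with
  `g(γ̇(0), γ̇(0)) ≤ 1`, for every `ε > 0`: `d_g(γ σ, γ 0) ≤ (1+ε)|σ|` for `σ` near `0`
  (distance ≤ length ≤ energy bound, `sq_edist_le_mul_energy_of_contMDiff`, and continuity of the
  speed).

Everything is proved; no definitions, no named facts.

## References

* R. H. Bamler, *Entropy and heat kernel bounds on a Ricci flow background*, arXiv:2008.07093
  (2020), §4.3, (4.7). [Bamler2020Entropy]
-/

noncomputable section

open Set Filter Function MeasureTheory
open scoped Manifold ContDiff Topology ENNReal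

namespace Literature.Geometry.Riemannian

open Lorentzian Lorentzian.PseudoRiemannianMetric MetricFlow

/-! ### From a Lipschitz bound on `Φ⁻¹ ∘ u` to a bound on `u'` -/

/-- `Φ'` is continuous (it is the Gaussian density `(4π)^{-1/2} e^{-x²/4}`, `deriv_Phi_eq`).
[cite: Bamler2023, §3, (3.1)] -/
theorem continuous_deriv_Phi : Continuous (deriv Phi) := by
  rw [deriv_Phi_eq]
  fun_prop

/-- **From a Lipschitz bound on `Φ⁻¹ ∘ u` to a bound on the derivative of `u`** (the step
"`|∇u| ≤ Φ'_t(s)` if `u = Φ_t(s)`" behind Bamler 2020a, (4.7)): let `u : ℝ → ℝ` take values in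
`(0, 1)`, be differentiable at `0` with derivative `u'`, and satisfy
`|Φ⁻¹(u σ) − Φ⁻¹(u 0)| ≤ L ρ(σ)` for all `σ`, where `L ≥ 0` and, for every `ε > 0`,
`ρ(σ) ≤ (1 + ε)|σ|` for `σ` near `0`. Then `|u'| ≤ L Φ'(Φ⁻¹(u 0))`: writing `u = Φ ∘ w`,
`w = Φ⁻¹ ∘ u`, the mean value theorem gives `|u σ − u 0| ≤ (sup Φ' near w 0) · L(1+ε)|σ|`, and
`Φ'` is continuous. [cite: Bamler2020Entropy, §4.3, (4.7)] -/
theorem abs_deriv_le_of_abs_PhiInv_sub_le {u ρ : ℝ → ℝ} {u' L : ℝ} (hu : HasDerivAt u u' 0)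
    (h01 : ∀ σ, u σ ∈ Ioo (0 : ℝ) 1) (hL : 0 ≤ L)
    (hLip : ∀ σ, |PhiInv (u σ) - PhiInv (u 0)| ≤ L * ρ σ)
    (hρ : ∀ ε : ℝ, 0 < ε → ∀ᶠ σ in 𝓝 (0 : ℝ), ρ σ ≤ (1 + ε) * |σ|) :
    |u'| ≤ L * deriv Phi (PhiInv (u 0)) := by
  set w : ℝ → ℝ := fun σ ↦ PhiInv (u σ) with hw
  have huw : ∀ σ, u σ = Phi (w σ) := fun σ ↦ (Phi_PhiInv (h01 σ).1 (h01 σ).2).symm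
  set F0 : ℝ := deriv Phi (w 0) with hF0
  have hF0pos : 0 < F0 := deriv_Phi_pos _
  -- it suffices to prove `|u'| ≤ L F0 (1 + η)` for every `η > 0`
  suffices key : ∀ η : ℝ, 0 < η → |u'| ≤ L * F0 * (1 + η) by
    have hLF : 0 ≤ L * F0 := mul_nonneg hL hF0pos.le
    refine le_of_forall_pos_lt_add fun δ hδ ↦ ?_
    rcases hLF.eq_or_lt with hLF0 | hLFpos
    · have h1 := key 1 one_pos
      rw [← hLF0, zero_mul] at h1
      show |u'| < L * F0 + δ
      linarith
    · have h1 := key (δ / (2 * (L * F0))) (by positivity)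
      have hL0 : L ≠ 0 := by
        rintro rfl
        simp at hLFpos
      have heq : L * F0 * (1 + δ / (2 * (L * F0))) = L * F0 + δ / 2 := by
        field_simp
      show |u'| < L * F0 + δ
      linarith
  intro η hη
  -- a margin `θ > 0` with `(1 + θ)² ≤ 1 + η`
  set θ : ℝ := η / (3 * (1 + η)) with hθ
  have hθpos : 0 < θ := by positivity
  have hθη : (1 + θ) * (1 + θ) ≤ 1 + η := by
    have h3 : 3 * θ ≤ η := by
      rw [hθ, show 3 * (η / (3 * (1 + η))) = η / (1 + η) by field_simp]
      exact div_le_self hη.le (by linarith)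
    have hθ1 : θ ≤ 1 := by
      rw [hθ, div_le_one (by positivity)]
      nlinarith
    nlinarith
  -- continuity of `Φ'` at `w 0`: `Φ' ξ ≤ F0 (1 + θ)` near `w 0`
  obtain ⟨δ₁, hδ₁, hΦ'⟩ : ∃ δ₁ > 0, ∀ ξ, |ξ - w 0| < δ₁ → deriv Phi ξ ≤ F0 * (1 + θ) := by
    have hc : ContinuousAt (deriv Phi) (w 0) := continuous_deriv_Phi.continuousAt
    have hlt : deriv Phi (w 0) < F0 * (1 + θ) := by
      rw [hF0]; nlinarith [deriv_Phi_pos (w 0)]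
    have hev := hc.eventually (gt_mem_nhds hlt)
    obtain ⟨δ₁, hδ₁, hball⟩ := Metric.eventually_nhds_iff.1 hev
    exact ⟨δ₁, hδ₁, fun ξ hξ ↦ (hball (by simpa [Real.dist_eq] using hξ)).le⟩
  -- `ρ σ ≤ (1 + θ)|σ|` near `0`
  have hρ' := hρ θ hθpos
  -- the slope of `u` at `0` tends to `u'`
  have hslope : Tendsto (fun σ ↦ σ⁻¹ * (u σ - u 0)) (𝓝[≠] 0) (𝓝 u') := by
    have := hu.tendsto_slope_zero
    simpa [zero_add, smul_eq_mul] using this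
  have habs : Tendsto (fun σ ↦ |σ⁻¹ * (u σ - u 0)|) (𝓝[≠] 0) (𝓝 |u'|) := hslope.abs
  -- eventually the absolute slope is bounded
  have hbound : ∀ᶠ σ in 𝓝[≠] (0 : ℝ), |σ⁻¹ * (u σ - u 0)| ≤ L * F0 * (1 + η) := by
    -- near `0`: `L (1 + θ) |σ| < δ₁`
    have hsmall : ∀ᶠ σ in 𝓝 (0 : ℝ), L * ((1 + θ) * |σ|) < δ₁ := by
      have hc : Continuous fun σ : ℝ ↦ L * ((1 + θ) * |σ|) := by fun_prop
      have h0 : (fun σ : ℝ ↦ L * ((1 + θ) * |σ|)) 0 < δ₁ := by simpa using hδ₁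
      exact hc.continuousAt.eventually (gt_mem_nhds h0)
    have hev : ∀ᶠ σ in 𝓝 (0 : ℝ), ρ σ ≤ (1 + θ) * |σ| ∧ L * ((1 + θ) * |σ|) < δ₁ :=
      hρ'.and hsmall
    rw [eventually_nhdsWithin_iff]
    filter_upwards [hev] with σ hσ hσne
    obtain ⟨hρσ, hδσ⟩ := hσ
    have hσne' : σ ≠ 0 := hσne
    -- `|w σ − w 0| ≤ L ρ σ ≤ L (1+θ)|σ| < δ₁`
    have hwL : |w σ - w 0| ≤ L * ((1 + θ) * |σ|) :=
      (hLip σ).trans (mul_le_mul_of_nonneg_left hρσ hL)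
    have hwδ : |w σ - w 0| < δ₁ := hwL.trans_lt hδσ
    -- mean value theorem for `Φ` on the segment between `w 0` and `w σ`
    have hMVT : |Phi (w σ) - Phi (w 0)| ≤ F0 * (1 + θ) * |w σ - w 0| := by
      have hconv : Convex ℝ (Metric.ball (w 0) δ₁) := convex_ball _ _
      have hdiff : ∀ ξ ∈ Metric.ball (w 0) δ₁, DifferentiableAt ℝ Phi ξ := fun ξ _ ↦
        differentiable_Phi ξ
      have hder : ∀ ξ ∈ Metric.ball (w 0) δ₁, ‖deriv Phi ξ‖ ≤ F0 * (1 + θ) := by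
        intro ξ hξ
        rw [Real.norm_eq_abs, abs_of_pos (deriv_Phi_pos ξ)]
        exact hΦ' ξ (by simpa [Real.dist_eq] using hξ)
      have h0 : w 0 ∈ Metric.ball (w 0) δ₁ := Metric.mem_ball_self hδ₁
      have hσb : w σ ∈ Metric.ball (w 0) δ₁ := by simpa [Real.dist_eq] using hwδ
      have := hconv.norm_image_sub_le_of_norm_deriv_le hdiff hder h0 hσb
      simpa [Real.norm_eq_abs] using this
    -- combine
    have hu' : |u σ - u 0| ≤ L * F0 * (1 + η) * |σ| := by
      rw [huw σ, huw 0]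
      calc |Phi (w σ) - Phi (w 0)| ≤ F0 * (1 + θ) * |w σ - w 0| := hMVT
        _ ≤ F0 * (1 + θ) * (L * ((1 + θ) * |σ|)) :=
          mul_le_mul_of_nonneg_left hwL (by positivity)
        _ = L * F0 * ((1 + θ) * (1 + θ)) * |σ| := by ring
        _ ≤ L * F0 * (1 + η) * |σ| := by
          apply mul_le_mul_of_nonneg_right _ (abs_nonneg σ)
          exact mul_le_mul_of_nonneg_left hθη (mul_nonneg hL hF0pos.le)
    rw [abs_mul, abs_inv, ← div_eq_inv_mul]
    rw [div_le_iff₀ (abs_pos.2 hσne')]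
    exact hu'
  exact le_of_tendsto habs hbound

/-! ### Distance along a curve of speed at most one -/

variable {E : Type*} [NormedAddCommGroup E] [NormedSpace ℝ E] [FiniteDimensional ℝ E]
  {H : Type*} [TopologicalSpace H] {I : ModelWithCorners ℝ E H} {M : Type*} [TopologicalSpace M]
  [ChartedSpace H M] [IsManifold I ∞ M]

/-- **Distance along a `C^∞` curve of speed `≤ 1` at `0`**: for a smooth Riemannian `g`, a `C^∞`
curve `γ` with `g(γ̇ 0, γ̇ 0) ≤ 1` and `ε > 0`, for all `σ` near `0` the distance `d_g(γ σ, γ 0)` is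
finite and at most `(1 + ε)|σ|` (distance ≤ length ≤ `(|σ| ∫ g(γ̇,γ̇))^{1/2}`,
`sq_edist_le_mul_energy_of_contMDiff`, and `g(γ̇ u, γ̇ u) ≤ (1+ε)²` for `u` near `0` by
continuity of the speed). [folklore] -/
theorem eventually_edist_toReal_le_of_speed_le_one
    (g : PseudoRiemannianMetric I ∞ E (TangentSpace I : M → Type _)) (hg : g.IsRiemannian)
    {γ : ℝ → M} (hγ : ContMDiff 𝓘(ℝ, ℝ) I ∞ γ)
    (h1 : g.val (γ 0) (velocity I γ 0) (velocity I γ 0) ≤ 1) {ε : ℝ} (hε : 0 < ε) :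
    ∀ᶠ σ in 𝓝 (0 : ℝ), g.edist hg (γ σ) (γ 0) ≠ ⊤ ∧
      (g.edist hg (γ σ) (γ 0)).toReal ≤ (1 + ε) * |σ| := by
  set f : ℝ → ℝ := fun u ↦ g.val (γ u) (velocity I γ u) (velocity I γ u) with hf
  have hTl := contMDiff_lift_velocity_of_contMDiff (I := I) hγ
  have hfs : ContMDiff 𝓘(ℝ, ℝ) 𝓘(ℝ, ℝ) ∞ f := fun u ↦
    contMDiffAt_val_apply_along g le_rfl (hTl u) (hTl u)
  have hfc : Continuous f := hfs.continuous
  -- `f u < (1 + ε)²` near `0`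
  have hlt : f 0 < (1 + ε) ^ 2 := by
    have : f 0 ≤ 1 := h1
    nlinarith
  obtain ⟨δ, hδ, hball⟩ :=
    Metric.eventually_nhds_iff.1 (hfc.continuousAt.eventually (gt_mem_nhds hlt))
  have hfle : ∀ u : ℝ, |u| < δ → f u ≤ (1 + ε) ^ 2 := fun u hu ↦
    (hball (by simpa [Real.dist_eq] using hu)).le
  -- the bound for a curve `c` smooth with speed² ≤ (1+ε)² on `[0, d]`
  have hcurve : ∀ (c : ℝ → M), ContMDiff 𝓘(ℝ, ℝ) I ∞ c → ∀ d : ℝ, 0 ≤ d →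
      (∀ u ∈ Icc 0 d, g.val (c u) (velocity I c u) (velocity I c u) ≤ (1 + ε) ^ 2) →
      g.edist hg (c 0) (c d) ≠ ⊤ ∧ (g.edist hg (c 0) (c d)).toReal ≤ (1 + ε) * d := by
    intro c hc d hd hsp
    obtain ⟨hfin, hsq⟩ := sq_edist_le_mul_energy_of_contMDiff g hg hc hd
    refine ⟨hfin, ?_⟩
    have hTc := contMDiff_lift_velocity_of_contMDiff (I := I) hc
    have hcs : Continuous fun u ↦ g.val (c u) (velocity I c u) (velocity I c u) :=
      (show ContMDiff 𝓘(ℝ, ℝ) 𝓘(ℝ, ℝ) ∞ _ from fun u ↦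
        contMDiffAt_val_apply_along g le_rfl (hTc u) (hTc u)).continuous
    have hint : ∫ u in (0 : ℝ)..d, g.val (c u) (velocity I c u) (velocity I c u) ≤
        ∫ _ in (0 : ℝ)..d, (1 + ε) ^ 2 :=
      intervalIntegral.integral_mono_on hd (hcs.intervalIntegrable _ _)
        intervalIntegrable_const hsp
    rw [intervalIntegral.integral_const, smul_eq_mul, sub_zero] at hint
    have hsq' : (g.edist hg (c 0) (c d)).toReal ^ 2 ≤ ((1 + ε) * d) ^ 2 := by
      calc (g.edist hg (c 0) (c d)).toReal ^ 2
          ≤ d * ∫ u in (0 : ℝ)..d, g.val (c u) (velocity I c u) (velocity I c u) := hsq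
        _ ≤ d * (d * (1 + ε) ^ 2) := mul_le_mul_of_nonneg_left hint hd
        _ = ((1 + ε) * d) ^ 2 := by ring
    exact (pow_le_pow_iff_left₀ ENNReal.toReal_nonneg (by positivity) two_ne_zero).1 hsq'
  filter_upwards [Metric.ball_mem_nhds (0 : ℝ) hδ] with σ hσ
  have hσ' : |σ| < δ := by simpa [Real.dist_eq] using hσ
  rcases le_or_gt 0 σ with hσ0 | hσ0
  · -- `σ ≥ 0`: the curve `γ` on `[0, σ]`
    have hsp : ∀ u ∈ Icc 0 σ, g.val (γ u) (velocity I γ u) (velocity I γ u) ≤ (1 + ε) ^ 2 :=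
      fun u hu ↦ hfle u (by
        rw [abs_of_nonneg hu.1]; exact lt_of_le_of_lt (hu.2.trans (le_abs_self σ)) hσ')
    obtain ⟨hfin, hle⟩ := hcurve γ hγ σ hσ0 hsp
    rw [g.edist_comm hg]
    exact ⟨hfin, by rwa [abs_of_nonneg hσ0]⟩
  · -- `σ < 0`: the reversed curve `u ↦ γ(−u)` on `[0, −σ]`
    have hcs : ContMDiff 𝓘(ℝ, ℝ) I ∞ (fun u : ℝ ↦ γ (-1 * u + 0)) :=
      hγ.comp ((contMDiff_const.mul contMDiff_id).add contMDiff_const)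
    have hsp : ∀ u ∈ Icc 0 (-σ), g.val (γ (-1 * u + 0))
        (velocity I (fun u : ℝ ↦ γ (-1 * u + 0)) u)
        (velocity I (fun u : ℝ ↦ γ (-1 * u + 0)) u) ≤ (1 + ε) ^ 2 := by
      intro u hu
      rw [velocity_comp_affine γ (-1) 0 u]
      simp only [map_smul, smul_eq_mul, FunLike.coe_smul, Pi.smul_apply]
      have hfu : f (-1 * u + 0) ≤ (1 + ε) ^ 2 := by
        refine hfle _ ?_
        have : |(-1 : ℝ) * u + 0| = u := by
          rw [add_zero, abs_mul, abs_neg, abs_one, one_mul, abs_of_nonneg hu.1]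
        rw [this]
        exact lt_of_le_of_lt (hu.2.trans (by rw [abs_of_neg hσ0])) hσ'
      have hf' : f (-1 * u + 0) = g.val (γ (-1 * u + 0)) (velocity I γ (-1 * u + 0))
          (velocity I γ (-1 * u + 0)) := rfl
      linarith
    obtain ⟨hfin, hle⟩ := hcurve _ hcs (-σ) (by linarith) hsp
    have e1 : (-1 : ℝ) * 0 + 0 = 0 := by ring
    have e2 : (-1 : ℝ) * (-σ) + 0 = σ := by ring
    simp only [e1, e2] at hfin hle
    rw [g.edist_comm hg]
    exact ⟨hfin, by rwa [abs_of_neg hσ0]⟩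

end Literature.Geometry.Riemannian

end
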